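import Summits.Schanuel.Schanuel.Theorems.ZilberEacRealLineSurfaceAll
import Summits.Schanuel.Schanuel.Theorems.ZilberEacGraphSurfaceDictionary
import Summits.Schanuel.Schanuel.Theorems.ZilberEacFibrationProj
import Literature.ModelTheory.Zilber.EACDensityNonFree
import HarnessLib

/-!
# Mantova–Masser's density question holds for EVERY surface of their case whose base is a line

HONEST FRAMING.  Cell `pub-schanuel` (Zilber's Exponential-Algebraic Closedness, case ladder;
host summit Schanuel), seat 2, gen 18.  Mantova–Masser (PLMS 129 (2024), §1 "Further remarks",
p. 5) ask whether the (unprojected) exponential points of an irreducible surface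
`S ⊆ ℂ² × (ℂˣ)²` of their case (dim-π-S-1-free): `dim cl π(S) = 1`, `cl π(S)` not a line of rational
slope — are Zariski dense in `S`.  **`unprojectedDense_of_mmCase_of_base_eq_line`**: the answer is
YES whenever the base curve `cl π(S)` is a LINE `x₁ = ax₀ + b` (`a, b ∈ ℂ` arbitrary: rational
slopes are excluded by the case itself, `isRationalSlopeLine_line_rat`).  Assembly of the
dictionary lemma (`exists_eq_graphSurface_of_mmCase` with `p = aX + b`: `W = W(p; P)`, `P`
irreducible with torus fibres over infinitely many base points), gen 17's capstone for non-real
slopes (`unprojectedDense_graphSurface_complete`, `Re(a·i) = -Im a ≠ 0`) and this generation's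
`unprojectedDensityQuestion_lineSurface_of_irrational_all` for real irrational slopes (rescaled and
tilted windows, accumulation or power-growth elimination).  (Vertical lines `x₀ = c` are of rational
slope.)  What is NOT covered: base curves of degree `≥ 2` other than graphs with the stated
conditions (equimodular class O67 (a), non-graph curves), `Fib(3,2)`, `EC(3,2)`.  NOT Schanuel's
conjecture (neither used nor implied; EAC ⇏ SC); `EC(3,2)` stays OPEN; the question stays OPEN in
general.  ON THE RUNG: by the fibration principle (THEOREM F′, gen 5,
`inter_expGraph_nonempty_of_unprojectedDense_proj`) every irreducible threefold `W ⊆ ℂ³ × ℂ³` meeting the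
torus whose projection `cl[Δ₂](W ∩ G³)` is a surface of the case over a line (resp. over a graph
`x₁ = p(x₀)` with `Re(lc(p)·i^{deg p}) ≠ 0`) meets the graph of exponentiation
(`inter_expGraph_nonempty_of_fibred_over_line` / `_over_graph`) — new unconditional members of the
open cell `EC(3,2)`, no rotundity or freeness hypothesis needed.
-/

noncomputable section

open Complex MvPolynomial
open Literature.NumberTheory.Transcendental Literature.ModelTheory.Zilber
open Literature.ModelTheory.ExponentialFields

set_option linter.dupNamespace false

namespace Summit.Schanuel.Schanuel.Theorems

/-- **Mantova–Masser's question for EVERY surface of the case over a line.**  Let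
`W ⊆ ℂ² × ℂ²` satisfy the hypotheses of case (dim-π-S-1-free) and let the Zariski closure of
`π(W ∩ G²)` be the line `x₁ = ax₀ + b`.  Then `I(W ∩ Γ_exp) = I(W)`: the exponential points of `W`
are Zariski dense.
[cite: MantovaMasser2023, §1 Further remarks, p. 5 (the question, open in general)] (new) -/
theorem unprojectedDense_of_mmCase_of_base_eq_line (a b : ℂ) {W : Set (Fin 2 ⊕ Fin 2 → ℂ)}
    (hmm : MMCaseDimPiOneFree W)
    (hbase : zeroLocus ℂ (vanishingIdeal ℂ (projAdd '' (W ∩ torusLocus ℂ 2))) =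
      {x : Fin 2 → ℂ | x 1 = a * x 0 + b}) :
    UnprojectedDense W := by
  have hline : ¬ IsRationalSlopeLine {x : Fin 2 → ℂ | x 1 = a * x 0 + b} := by
    rw [← hbase]; exact hmm.2.2.2.2
  have ha : ∀ r : ℚ, a ≠ (r : ℂ) := by
    rintro r rfl
    exact hline (isRationalSlopeLine_line_rat r b)
  have hbase' : zeroLocus ℂ (vanishingIdeal ℂ (projAdd '' (W ∩ torusLocus ℂ 2))) =
      {x : Fin 2 → ℂ | x 1 = (linePoly a b).eval (x 0)} := by
    rw [hbase]; ext x; simp only [Set.mem_setOf_eq, eval_linePoly]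
  obtain ⟨P, hP, hfib, rfl⟩ := exists_eq_graphSurface_of_mmCase (linePoly a b) hmm hbase'
  by_cases him : a.im ≠ 0
  · -- non-real slope: gen 17's capstone with `p = aX + b`
    have ha0 : a ≠ 0 := by rintro rfl; exact him (by simp)
    have hd : (linePoly a b).natDegree = 1 := by
      rw [linePoly]; exact Polynomial.natDegree_linear ha0
    have hlc : (linePoly a b).leadingCoeff = a := by
      rw [linePoly]; exact Polynomial.leadingCoeff_linear ha0
    refine unprojectedDense_graphSurface_complete (linePoly a b) (by rw [hd]) ?_ hP hfib
    rw [hlc, hd, pow_one, Complex.mul_I_re]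
    exact neg_ne_zero.2 him
  · -- real slope, irrational by the case hypothesis
    push Not at him
    have hare : ((a.re : ℝ) : ℂ) = a := by
      apply Complex.ext <;> simp [him]
    have hirr : Irrational a.re := by
      rintro ⟨r, hr⟩
      exact ha r (by rw [← hare, ← hr, Complex.ofReal_ratCast])
    have h := (unprojectedDensityQuestion_lineSurface_of_irrational_all (a := a.re) b hirr hP hfib).2
    rwa [hare] at h

/-- **… stated with the case binder spelled out**: for `W ⊆ ℂ² × ℂ²` irreducible closed of dimension
`2` with non-empty torus part, `dim cl π(W ∩ G²) = 1`, `cl π(W ∩ G²)` not a line of rational slope,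
and `cl π(W ∩ G²)` a line, the exponential points are Zariski dense. (new) -/
theorem unprojectedDense_of_base_line (a b : ℂ) {W : Set (Fin 2 ⊕ Fin 2 → ℂ)}
    (hW : IsIrreducibleClosed ℂ W) (hne : (W ∩ torusLocus ℂ 2).Nonempty)
    (hdim : zariskiDim ℂ W = (2 : ℕ)) (h1 : addProjDim ℂ 2 W = (1 : ℕ))
    (hnot : ¬ IsRationalSlopeLine (zeroLocus ℂ (vanishingIdeal ℂ (projAdd '' (W ∩ torusLocus ℂ 2)))))
    (hbase : zeroLocus ℂ (vanishingIdeal ℂ (projAdd '' (W ∩ torusLocus ℂ 2))) =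
      {x : Fin 2 → ℂ | x 1 = a * x 0 + b}) :
    UnprojectedDense W :=
  unprojectedDense_of_mmCase_of_base_eq_line a b ⟨hW, hne, hdim, h1, hnot⟩ hbase


/-! ## On the rung: threefolds fibred in curves over such surfaces meet `Γ_exp` -/

/-- **New members of `EC(3,2)` (line bases).**  An irreducible threefold `W ⊆ ℂ³ × ℂ³` of dimension
`3` meeting the torus, with `dim cl[Δ₂](W ∩ G³) = 2`, whose projected surface
`V' = cl pr(W ∩ G³) ⊆ ℂ² × ℂ²` (forget `x₂, y₂`) is in Mantova–Masser's case with base curve a line,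
meets the graph of exponentiation (THEOREM F′ + the all-lines theorem; no rotundity or freeness
hypothesis). [cite: MantovaMasser2023, §1 Further remarks, p. 5] (new) -/
theorem inter_expGraph_nonempty_of_fibred_over_line (a b : ℂ)
    {W : Set (Fin (2 + 1) ⊕ Fin (2 + 1) → ℂ)}
    (hW : IsIrreducibleClosed ℂ W) (hne : (W ∩ torusLocus ℂ (2 + 1)).Nonempty)
    (hdim : zariskiDim ℂ W = (2 + 1 : ℕ))
    (hfib : zariskiDim ℂ (matrixAct (dropLastMat 2) '' (W ∩ torusLocus ℂ (2 + 1))) = (2 : ℕ))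
    (hmm : MMCaseDimPiOneFree (zeroLocus ℂ (vanishingIdeal ℂ
      ((fun (w : Fin (2 + 1) ⊕ Fin (2 + 1) → ℂ) (t : Fin 2 ⊕ Fin 2) =>
        w (Sum.map Fin.castSucc Fin.castSucc t)) '' (W ∩ torusLocus ℂ (2 + 1))))))
    (hbase : zeroLocus ℂ (vanishingIdeal ℂ (projAdd '' (zeroLocus ℂ (vanishingIdeal ℂ
      ((fun (w : Fin (2 + 1) ⊕ Fin (2 + 1) → ℂ) (t : Fin 2 ⊕ Fin 2) =>
        w (Sum.map Fin.castSucc Fin.castSucc t)) '' (W ∩ torusLocus ℂ (2 + 1)))) ∩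
        torusLocus ℂ 2))) = {x : Fin 2 → ℂ | x 1 = a * x 0 + b}) :
    (W ∩ expGraph ℂ (2 + 1)).Nonempty :=
  inter_expGraph_nonempty_of_unprojectedDense_proj hW hne hdim hfib
    (unprojectedDense_of_mmCase_of_base_eq_line a b hmm hbase)

/-- **New members of `EC(3,2)` (graph bases with non-degenerate leading term).**  The same over a
base curve `x₁ = p(x₀)`, `deg p ≥ 1`, `Re(lc(p)·i^{deg p}) ≠ 0`.
[cite: MantovaMasser2023, §1 Further remarks, p. 5] (new) -/
theorem inter_expGraph_nonempty_of_fibred_over_graph (p : Polynomial ℂ) (hd : 1 ≤ p.natDegree)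
    (hre : (p.leadingCoeff * I ^ p.natDegree).re ≠ 0)
    {W : Set (Fin (2 + 1) ⊕ Fin (2 + 1) → ℂ)}
    (hW : IsIrreducibleClosed ℂ W) (hne : (W ∩ torusLocus ℂ (2 + 1)).Nonempty)
    (hdim : zariskiDim ℂ W = (2 + 1 : ℕ))
    (hfib : zariskiDim ℂ (matrixAct (dropLastMat 2) '' (W ∩ torusLocus ℂ (2 + 1))) = (2 : ℕ))
    (hmm : MMCaseDimPiOneFree (zeroLocus ℂ (vanishingIdeal ℂ
      ((fun (w : Fin (2 + 1) ⊕ Fin (2 + 1) → ℂ) (t : Fin 2 ⊕ Fin 2) =>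
        w (Sum.map Fin.castSucc Fin.castSucc t)) '' (W ∩ torusLocus ℂ (2 + 1))))))
    (hbase : zeroLocus ℂ (vanishingIdeal ℂ (projAdd '' (zeroLocus ℂ (vanishingIdeal ℂ
      ((fun (w : Fin (2 + 1) ⊕ Fin (2 + 1) → ℂ) (t : Fin 2 ⊕ Fin 2) =>
        w (Sum.map Fin.castSucc Fin.castSucc t)) '' (W ∩ torusLocus ℂ (2 + 1)))) ∩
        torusLocus ℂ 2))) = {x : Fin 2 → ℂ | x 1 = p.eval (x 0)}) :
    (W ∩ expGraph ℂ (2 + 1)).Nonempty :=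
  inter_expGraph_nonempty_of_unprojectedDense_proj hW hne hdim hfib
    (unprojectedDense_of_mmCase_of_base_eq_graph p hd hre hmm hbase)

end Summit.Schanuel.Schanuel.Theorems
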